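import Mathlib
import Summits.KontsevichZagierPeriods.KontsevichZagierPeriods.Theorems.SoloInformedRealTensorSemiGeneric
import Summits.KontsevichZagierPeriods.KontsevichZagierPeriods.Theorems.SoloInformedAlgebraicParameterTransfer
import HarnessLib

/-!
# Solo-informed: THEOREM T⊗ for arbitrary real scalar tuples — `P_ℚ ⊗_k ℝ → P_ℝ` is injective

Programme note F-s224′, general case (files A = `SoloInformedParamScaledConst`,
B1 = `SoloInformedRealScaledPropagation`, B2 = `SoloInformedRealTensorSemiGeneric` treated the
semi-generic scalars `(1, t)`, `t` algebraically independent over `ℚ`).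

**THEOREM T⊗ (general form; conditional on the Lion–Rolin preparation fact
`semialgebraicPreparation` only).**  Let `k = ℝ ∩ ℚ̄ = algebraicClosure ℚ ℝ` be the field of real
algebraic numbers, `c : Fin M → ℝ` linearly independent over `k`, and `q₁, …, q_M ∈ FormalRep ℚ`
formal `ℤ`-combinations of absolutely convergent integrals with `ℚ`-semialgebraic data.  Then
`∑ᵢ cᵢ • (qᵢ ⊗ ℝ) ∈ relations ℝ ⟺ every qᵢ ∈ relations ℚ`
(`soloInformed_realTensor_linIndep_iff_prep`; `cᵢ •` = integrand scaling `soloInformedRealScale`):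
classes of `ℚ`-data that are `k`-linearly independent in `P_ℚ = FormalRep ℚ ⧸ relations ℚ` stay
`ℝ`-linearly independent in `P_ℝ`; the scalar extension `P_ℚ ⊗_k ℝ → P_ℝ` of the four-move
Kontsevich–Zagier calculus is injective.  This contains THEOREM T (`c = 1`, file
`SoloInformedRealParamInjective`), THEOREM R (scalars `(1, v)`, `v ∉ k`), file B2, and new mixed
shapes: `soloInformed_realTensor_linIndep_cons_iff_prep` (scalars `(1, c)`) and
`soloInformed_realTensor_powers_iff_prep` (scalars `(1, τ, …, τⁿ)`, `τ` transcendental over `ℚ`,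
e.g. `π`: a polynomial identity in `τ` between classes of `ℚ`-defined integrals in `P_ℝ` holds only
coefficientwise in `P_ℚ`).  The tensor is over `k`, not `ℚ`: `√2 • ([0,1] ⊗ ℝ) ≡ [0,√2] ⊗ ℝ`.

Proof (new; no Zariski closures, no genericity).  Pass to pair normal forms `qᵢ ≡ [aᵢ] − [bᵢ]`
and the scaled sum `x(s) = ∑ᵢ sᵢ • (([aᵢ] − [bᵢ]) ⊗ ℝ)` (file B1): by
`soloInformed_scaledSum_propagation_prep`, `x(s)` is a `KZ_ℝ`-relation for all `s` in a
`ℚ`-semialgebraic set `T ∋ c`.  The set `W = {s | x(s) ∈ relations ℝ} ⊇ T` is a real subspace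
(integrand scaling is linear modulo the four moves, file `SoloInformedRealScalars`), and its
`k`-points `W(k)` form a `k`-subspace of `k^M`.  If `W(k) = k^M`, each coordinate vector lies in
`W`, so each `([aᵢ] − [bᵢ]) ⊗ ℝ` is a relation and THEOREM T descends to `qᵢ ∈ relations ℚ`.
Otherwise a nonzero `k`-linear form `λ` kills `W(k)` (`Submodule.exists_le_ker_of_lt_top`); every
rational box `B ∋ c` meets `T` in a non-empty `ℚ`-semialgebraic set, which has a point with
real-algebraic coordinates (`soloInformed_exists_algebraic_point`, the shadow of `ℝ_alg ≼ ℝ`) lying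
in `W(k)`; so `λ` vanishes at real-algebraic points arbitrarily near `c`, hence `λ(c) = 0` by
continuity — contradicting the `k`-linear independence of `c`.

References: M. Kontsevich, D. Zagier, *Periods* (2001), §1.2; J. Bochnak, M. Coste, M.-F. Roy,
*Real Algebraic Geometry* (1998), §§2.1, 5.2; J.-M. Lion, J.-P. Rolin (1998) (preparation).
-/

noncomputable section

open Set Filter Topology Literature.ModelTheory.ExponentialFields
  Literature.NumberTheory.Transcendental

namespace Summit.KontsevichZagierPeriods.KontsevichZagierPeriods.Theorems

/-! ### Scalar combinations `∑ᵢ sᵢ • Xᵢ` are linear in `s` modulo the four moves -/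

/-- The zero scalar vector gives a relation: `∑ᵢ 0 • Xᵢ ∈ relations ℝ`.
[cite: KontsevichZagier2001, §1.2] -/
theorem soloInformed_sumRealScale_zero_mem_relations {M : ℕ} (X : Fin M → KZOver.FormalRep ℝ) :
    ∑ i, soloInformedRealScale ((0 : Fin M → ℝ) i) (X i) ∈ KZOver.relations ℝ :=
  sum_mem fun i _ => by
    rw [Pi.zero_apply]
    exact soloInformed_realScale_zero_mem_relations (X i)

/-- Additivity in the scalar vector modulo relations: if `∑ᵢ aᵢ • Xᵢ` and `∑ᵢ bᵢ • Xᵢ` are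
relations then so is `∑ᵢ (aᵢ + bᵢ) • Xᵢ`. [cite: KontsevichZagier2001, §1.2] -/
theorem soloInformed_sumRealScale_add_mem_relations {M : ℕ} (X : Fin M → KZOver.FormalRep ℝ)
    {a b : Fin M → ℝ} (ha : ∑ i, soloInformedRealScale (a i) (X i) ∈ KZOver.relations ℝ)
    (hb : ∑ i, soloInformedRealScale (b i) (X i) ∈ KZOver.relations ℝ) :
    ∑ i, soloInformedRealScale ((a + b) i) (X i) ∈ KZOver.relations ℝ := by
  have h : (∑ i, soloInformedRealScale ((a + b) i) (X i)) -
      ∑ i, soloInformedRealScale (a i) (X i) - ∑ i, soloInformedRealScale (b i) (X i) ∈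
      KZOver.relations ℝ := by
    rw [← Finset.sum_sub_distrib, ← Finset.sum_sub_distrib]
    exact sum_mem fun i _ => soloInformed_realScale_add_mem_relations (a i) (b i) (X i)
  have h₂ := add_mem h hb
  rw [sub_add_cancel] at h₂
  have h₃ := add_mem h₂ ha
  rwa [sub_add_cancel] at h₃

/-- Homogeneity in the scalar vector modulo relations: if `∑ᵢ aᵢ • Xᵢ` is a relation then so is
`∑ᵢ (r aᵢ) • Xᵢ = r • ∑ᵢ aᵢ • Xᵢ`. [cite: KontsevichZagier2001, §1.2] -/
theorem soloInformed_sumRealScale_smul_mem_relations {M : ℕ} (X : Fin M → KZOver.FormalRep ℝ)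
    (r : ℝ) {a : Fin M → ℝ} (ha : ∑ i, soloInformedRealScale (a i) (X i) ∈ KZOver.relations ℝ) :
    ∑ i, soloInformedRealScale ((r • a) i) (X i) ∈ KZOver.relations ℝ := by
  have h : ∑ i, soloInformedRealScale ((r • a) i) (X i) =
      soloInformedRealScale r (∑ i, soloInformedRealScale (a i) (X i)) := by
    rw [map_sum]
    refine Finset.sum_congr rfl fun i _ => ?_
    rw [Pi.smul_apply, smul_eq_mul, soloInformed_realScale_mul]
  rw [h]
  exact soloInformed_realScale_mem_relations r ha

/-- Coordinate vectors: if `∑ⱼ δᵢⱼ • Xⱼ` is a relation then `Xᵢ` is a relation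
(`1 • Xᵢ = Xᵢ` and `0 • Xⱼ ≡ 0`). [cite: KontsevichZagier2001, §1.2] -/
theorem soloInformed_mem_relations_of_sumRealScale_single {M : ℕ}
    (X : Fin M → KZOver.FormalRep ℝ) (i : Fin M)
    (h : ∑ j, soloInformedRealScale (if i = j then (1 : ℝ) else 0) (X j) ∈ KZOver.relations ℝ) :
    X i ∈ KZOver.relations ℝ := by
  classical
  have hsplit : ∑ j ∈ Finset.univ.erase i,
      soloInformedRealScale (if i = j then (1 : ℝ) else 0) (X j) =
      (∑ j, soloInformedRealScale (if i = j then (1 : ℝ) else 0) (X j)) -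
        soloInformedRealScale (if i = i then (1 : ℝ) else 0) (X i) :=
    Finset.sum_erase_eq_sub (Finset.mem_univ i)
  have hrest : ∑ j ∈ Finset.univ.erase i,
      soloInformedRealScale (if i = j then (1 : ℝ) else 0) (X j) ∈ KZOver.relations ℝ :=
    sum_mem fun j hj => by
      rw [if_neg (Finset.ne_of_mem_erase hj).symm]
      exact soloInformed_realScale_zero_mem_relations (X j)
  rw [hsplit, if_pos rfl, soloInformed_realScale_one] at hrest
  have h₂ := sub_mem h hrest
  rwa [sub_sub_cancel] at h₂

/-! ### Real-algebraic points of `ℚ`-semialgebraic sets near a given point -/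

/-- Open boxes with rational corners are `ℚ`-semialgebraic. [cite: BochnakCosteRoy1998, §2.1] -/
theorem soloInformed_isSemialgebraic_ratBox {M : ℕ} (l u : Fin M → ℚ) :
    IsSemialgebraic ℚ {x : Fin M → ℝ | ∀ i, (l i : ℝ) < x i ∧ x i < (u i : ℝ)} := by
  have hset : {x : Fin M → ℝ | ∀ i, (l i : ℝ) < x i ∧ x i < (u i : ℝ)} =
      ⋂ i ∈ (Finset.univ : Finset (Fin M)),
        ({x : Fin M → ℝ | MvPolynomial.aeval x (MvPolynomial.C (l i) : MvPolynomial (Fin M) ℚ) <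
            MvPolynomial.aeval x (MvPolynomial.X i : MvPolynomial (Fin M) ℚ)} ∩
          {x : Fin M → ℝ | MvPolynomial.aeval x (MvPolynomial.X i : MvPolynomial (Fin M) ℚ) <
            MvPolynomial.aeval x (MvPolynomial.C (u i) : MvPolynomial (Fin M) ℚ)}) := by
    ext x
    simp only [mem_setOf_eq, Finset.mem_univ, iInter_true, mem_iInter, mem_inter_iff,
      MvPolynomial.aeval_C, MvPolynomial.aeval_X, eq_ratCast]
  rw [hset]
  exact IsSemialgebraic.biInter _ _ fun i _ =>
    (isSemialgebraic_setOf_eval_lt _ _).inter (isSemialgebraic_setOf_eval_lt _ _)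

/-- **Real-algebraic points of a `ℚ`-semialgebraic set are dense in it**: for `c ∈ T` and
`ε > 0` there is a point of `T` with coordinates algebraic over `ℚ`, `ε`-close to `c` in every
coordinate (`soloInformed_exists_algebraic_point` on `T ∩` a rational box). [cite: BochnakCosteRoy1998, §5.2] -/
theorem soloInformed_exists_algebraic_point_near {M : ℕ} {T : Set (Fin M → ℝ)}
    (hT : IsSemialgebraic ℚ T) {c : Fin M → ℝ} (hc : c ∈ T) {ε : ℝ} (hε : 0 < ε) :
    ∃ v ∈ T, (∀ i, IsAlgebraic ℚ (v i)) ∧ ∀ i, |v i - c i| < ε := by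
  have hl : ∀ i, ∃ q : ℚ, c i - ε < q ∧ (q : ℝ) < c i := fun i =>
    exists_rat_btwn (by linarith)
  have hu : ∀ i, ∃ q : ℚ, c i < q ∧ (q : ℝ) < c i + ε := fun i =>
    exists_rat_btwn (by linarith)
  choose l hl₁ hl₂ using hl
  choose u hu₁ hu₂ using hu
  have hB : IsSemialgebraic ℚ {x : Fin M → ℝ | ∀ i, (l i : ℝ) < x i ∧ x i < (u i : ℝ)} :=
    soloInformed_isSemialgebraic_ratBox l u
  have hcB : c ∈ {x : Fin M → ℝ | ∀ i, (l i : ℝ) < x i ∧ x i < (u i : ℝ)} :=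
    fun i => ⟨hl₂ i, hu₁ i⟩
  obtain ⟨v, ⟨hvT, hvB⟩, hv⟩ := soloInformed_exists_algebraic_point (hT.inter hB) ⟨c, hc, hcB⟩
  refine ⟨v, hvT, hv, fun i => ?_⟩
  rw [abs_sub_lt_iff]
  constructor <;> linarith [(hvB i).1, (hvB i).2, hl₁ i, hu₂ i]

/-! ### THEOREM T⊗ for arbitrary `k`-linearly independent real scalar tuples -/

/-- **THEOREM T⊗, general form, elementary hypothesis** (conditional on the preparation fact).
If no nontrivial combination `∑ᵢ gᵢ cᵢ` with real-algebraic coefficients `gᵢ` vanishes, then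
`∑ᵢ cᵢ • (qᵢ ⊗ ℝ) ∈ relations ℝ` forces every `qᵢ ∈ relations ℚ` (proof in the module docstring:
propagation to a `ℚ`-semialgebraic set of scalar vectors, the subspace `W`, density of
real-algebraic points, dual `k`-linear form). [cite: KontsevichZagier2001, §1.2] -/
theorem soloInformed_realTensor_of_prep (hprep : semialgebraicPreparation) {M : ℕ}
    {c : Fin M → ℝ}
    (hc : ∀ g : Fin M → ℝ, (∀ i, IsAlgebraic ℚ (g i)) → ∑ i, g i * c i = 0 → ∀ i, g i = 0)
    (q : Fin M → KZOver.FormalRep ℚ)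
    (h : ∑ i, soloInformedRealScale (c i) (KZOver.baseChange ℚ ℝ (q i)) ∈ KZOver.relations ℝ) :
    ∀ i, q i ∈ KZOver.relations ℚ := by
  classical
  choose a b hab using fun i => soloInformed_exists_sigma_pair_of_rat (q i)
  -- `X i = ([a i] − [b i]) ⊗ ℝ ≡ q i ⊗ ℝ`
  let X : Fin M → KZOver.FormalRep ℝ := fun i =>
    KZOver.baseChange ℚ ℝ (KZOver.of (a i).2 - KZOver.of (b i).2)
  have hX : ∀ i, KZOver.baseChange ℚ ℝ (q i) - X i ∈ KZOver.relations ℝ := fun i => by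
    have h₁ := KZOver.baseChange_mem_relations ℝ (hab i)
    rwa [map_sub] at h₁
  have hsum : ∀ s : Fin M → ℝ,
      soloInformedScaledSum (Sum.elim a b) (Sum.elim id id)
        (Sum.elim (fun _ => (1 : ℤ)) (fun _ => -1)) s = ∑ i, soloInformedRealScale (s i) (X i) :=
    fun s => soloInformed_scaledSum_pair a b s
  have hcongr : ∀ s : Fin M → ℝ,
      (∑ i, soloInformedRealScale (s i) (X i)) -
        ∑ i, soloInformedRealScale (s i) (KZOver.baseChange ℚ ℝ (q i)) ∈ KZOver.relations ℝ := by
    intro s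
    rw [← Finset.sum_sub_distrib]
    refine sum_mem fun i _ => ?_
    rw [← map_sub]
    refine soloInformed_realScale_mem_relations (s i) ?_
    have h₁ := neg_mem (hX i)
    rwa [neg_sub] at h₁
  have hrel₀ : soloInformedScaledSum (Sum.elim a b) (Sum.elim id id)
      (Sum.elim (fun _ => (1 : ℤ)) (fun _ => -1)) c ∈ KZOver.relations ℝ := by
    rw [hsum]
    have h₂ := add_mem (hcongr c) h
    rwa [sub_add_cancel] at h₂
  -- file B1: the scaled sum stays a relation on a `ℚ`-semialgebraic set `T ∋ c`
  obtain ⟨T, hT, hcT, hTrel⟩ := soloInformed_scaledSum_propagation_prep hprep _ _ _ hrel₀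
  have hW : ∀ s ∈ T, ∑ i, soloInformedRealScale (s i) (X i) ∈ KZOver.relations ℝ := by
    intro s hs
    rw [← hsum]
    exact hTrel s hs
  -- it suffices to show that every `X i` is a relation (THEOREM T then descends to `ℚ`)
  suffices hXrel : ∀ i, X i ∈ KZOver.relations ℝ by
    intro i
    have h₁ := add_mem (hX i) (hXrel i)
    rw [sub_add_cancel] at h₁
    exact (soloInformed_baseChange_mem_relations_iff_prep hprep (q i)).1 h₁
  -- the real-algebraic scalar vectors giving a relation: a subspace of `k^M`, `k = ℝ ∩ ℚ̄`
  let WK : Submodule (algebraicClosure ℚ ℝ) (Fin M → algebraicClosure ℚ ℝ) :=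
    { carrier := {v | ∑ i, soloInformedRealScale ((v i : ℝ)) (X i) ∈ KZOver.relations ℝ}
      add_mem' := by
        intro v w hv hw
        have h₁ := soloInformed_sumRealScale_add_mem_relations X hv hw
        simpa only [mem_setOf_eq, Pi.add_apply, AddMemClass.coe_add] using h₁
      zero_mem' := by
        simpa only [mem_setOf_eq, Pi.zero_apply, ZeroMemClass.coe_zero] using
          soloInformed_sumRealScale_zero_mem_relations X
      smul_mem' := by
        intro r v hv
        have h₁ := soloInformed_sumRealScale_smul_mem_relations X (r : ℝ) hv
        simpa only [mem_setOf_eq, Pi.smul_apply, smul_eq_mul, MulMemClass.coe_mul] using h₁ }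
  have hmemWK : ∀ v : Fin M → algebraicClosure ℚ ℝ,
      v ∈ WK ↔ ∑ i, soloInformedRealScale ((v i : ℝ)) (X i) ∈ KZOver.relations ℝ :=
    fun v => Iff.rfl
  by_cases htop : WK = ⊤
  · -- every coordinate vector is a real-algebraic point of `W`
    intro i
    refine soloInformed_mem_relations_of_sumRealScale_single X i ?_
    have hmem : (fun j => if i = j then (1 : algebraicClosure ℚ ℝ) else 0) ∈ WK := by
      rw [htop]
      exact Submodule.mem_top
    rw [hmemWK] at hmem
    have key : ∑ j, soloInformedRealScale (if i = j then (1 : ℝ) else 0) (X j) =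
        ∑ j, soloInformedRealScale
          (((fun j => if i = j then (1 : algebraicClosure ℚ ℝ) else 0) j : ℝ)) (X j) :=
      Finset.sum_congr rfl fun j _ => by
        simp only
        split_ifs <;> simp
    rw [key]
    exact hmem
  · -- a nonzero real-algebraic linear form `λ` vanishing on `W(k)`
    exfalso
    obtain ⟨f, hf0, hle⟩ := Submodule.exists_le_ker_of_lt_top WK (lt_top_iff_ne_top.2 htop)
    obtain ⟨lam, hlam⟩ : ∃ lam : Fin M → algebraicClosure ℚ ℝ,
        ∀ v : Fin M → algebraicClosure ℚ ℝ, f v = ∑ i, v i * lam i :=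
      ⟨fun i => f (fun j => if i = j then 1 else 0), fun v => by
        rw [LinearMap.pi_apply_eq_sum_univ f v]
        simp only [smul_eq_mul]⟩
    have hvan : ∀ v ∈ WK, ∑ i, (v i : ℝ) * (lam i : ℝ) = 0 := by
      intro v hv
      have h₁ : f v = 0 := LinearMap.mem_ker.1 (hle hv)
      rw [hlam] at h₁
      have h₂ := congrArg (fun x : algebraicClosure ℚ ℝ => (x : ℝ)) h₁
      simpa only [AddSubmonoidClass.coe_finsetSum, MulMemClass.coe_mul, ZeroMemClass.coe_zero]
        using h₂
    -- `λ(c) = 0` by density of real-algebraic points of `T` near `c`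
    have hLc : ∑ i, c i * (lam i : ℝ) = 0 := by
      by_contra hne
      have hδ : 0 < |∑ i, c i * (lam i : ℝ)| := abs_pos.2 hne
      have hΛ : 0 ≤ ∑ i, |(lam i : ℝ)| := Finset.sum_nonneg fun i _ => abs_nonneg _
      have hΛ1 : (0 : ℝ) < ∑ i, |(lam i : ℝ)| + 1 := by linarith
      obtain ⟨v, hvT, hvalg, hvc⟩ :=
        soloInformed_exists_algebraic_point_near hT hcT (div_pos hδ hΛ1)
      let w : Fin M → algebraicClosure ℚ ℝ := fun i => ⟨v i, mem_algebraicClosure_iff.2 (hvalg i)⟩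
      have hw : w ∈ WK := by
        rw [hmemWK]
        exact hW v hvT
      have h0 : ∑ i, v i * (lam i : ℝ) = 0 := hvan w hw
      have hdiff : ∑ i, c i * (lam i : ℝ) = ∑ i, (c i - v i) * (lam i : ℝ) := by
        rw [Finset.sum_congr rfl fun i _ => sub_mul (c i) (v i) (lam i : ℝ),
          Finset.sum_sub_distrib, h0, sub_zero]
      have hbound : |∑ i, c i * (lam i : ℝ)| ≤
          |∑ i, c i * (lam i : ℝ)| / (∑ i, |(lam i : ℝ)| + 1) * ∑ i, |(lam i : ℝ)| :=
        calc |∑ i, c i * (lam i : ℝ)| = |∑ i, (c i - v i) * (lam i : ℝ)| := by rw [← hdiff]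
          _ ≤ ∑ i, |(c i - v i) * (lam i : ℝ)| := Finset.abs_sum_le_sum_abs _ _
          _ = ∑ i, |c i - v i| * |(lam i : ℝ)| := Finset.sum_congr rfl fun i _ => abs_mul _ _
          _ ≤ ∑ i, |∑ i, c i * (lam i : ℝ)| / (∑ i, |(lam i : ℝ)| + 1) * |(lam i : ℝ)| := by
              gcongr with i _
              rw [abs_sub_comm]
              exact (hvc i).le
          _ = |∑ i, c i * (lam i : ℝ)| / (∑ i, |(lam i : ℝ)| + 1) * ∑ i, |(lam i : ℝ)| := by
              rw [← Finset.mul_sum]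
      have hlt : |∑ i, c i * (lam i : ℝ)| / (∑ i, |(lam i : ℝ)| + 1) * ∑ i, |(lam i : ℝ)| <
          |∑ i, c i * (lam i : ℝ)| := by
        rw [div_mul_eq_mul_div, div_lt_iff₀ hΛ1]
        exact mul_lt_mul_of_pos_left (lt_add_one _) hδ
      linarith
    -- the `k`-linear independence of `c` kills `λ`, hence `f = 0`
    have hlam0 : ∀ i, lam i = 0 := by
      have hsum0 : ∑ i, (lam i : ℝ) * c i = 0 := by
        rw [← hLc]
        exact Finset.sum_congr rfl fun i _ => mul_comm _ _
      intro i
      have h₁ := hc (fun i => (lam i : ℝ)) (fun i => mem_algebraicClosure_iff.1 (lam i).2) hsum0 i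
      exact Subtype.ext (by simpa using h₁)
    refine hf0 (LinearMap.ext fun v => ?_)
    rw [hlam, LinearMap.zero_apply]
    exact Finset.sum_eq_zero fun i _ => by rw [hlam0 i, mul_zero]

/-- Linear independence over the real algebraic numbers `k = algebraicClosure ℚ ℝ`, unfolded: no
nontrivial combination with real-algebraic coefficients vanishes. [folklore] -/
theorem soloInformed_eq_zero_of_linearIndependent_algebraicClosure {M : ℕ} {c : Fin M → ℝ}
    (hc : LinearIndependent (algebraicClosure ℚ ℝ) c) (g : Fin M → ℝ)
    (hg : ∀ i, IsAlgebraic ℚ (g i)) (h : ∑ i, g i * c i = 0) : ∀ i, g i = 0 := by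
  let g' : Fin M → algebraicClosure ℚ ℝ := fun i => ⟨g i, mem_algebraicClosure_iff.2 (hg i)⟩
  have h' : ∑ i, g' i • c i = 0 := by
    have h₁ : ∀ i, g' i • c i = g i * c i := fun i => by
      rw [IntermediateField.smul_def, smul_eq_mul]
    rw [Finset.sum_congr rfl fun i _ => h₁ i]
    exact h
  intro i
  have h₁ := Fintype.linearIndependent_iff.1 hc g' h' i
  have h₂ : ((g' i : algebraicClosure ℚ ℝ) : ℝ) = 0 := by
    rw [h₁, ZeroMemClass.coe_zero]
  exact h₂

/-- **THEOREM T⊗, general form** (conditional on the preparation fact `semialgebraicPreparation`).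
For a real scalar tuple `c` linearly independent over the field of real algebraic numbers
`k = algebraicClosure ℚ ℝ` and `ℚ`-data `qᵢ`:
`∑ᵢ cᵢ • (qᵢ ⊗ ℝ) ∈ relations ℝ ↔ ∀ i, qᵢ ∈ relations ℚ` — the scalar extension
`P_ℚ ⊗_k ℝ → P_ℝ` of the four-move calculus is injective (`P_K = FormalRep K ⧸ relations K`).
[cite: KontsevichZagier2001, §1.2] -/
theorem soloInformed_realTensor_linIndep_iff_prep (hprep : semialgebraicPreparation) {M : ℕ}
    {c : Fin M → ℝ} (hc : LinearIndependent (algebraicClosure ℚ ℝ) c)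
    (q : Fin M → KZOver.FormalRep ℚ) :
    ∑ i, soloInformedRealScale (c i) (KZOver.baseChange ℚ ℝ (q i)) ∈ KZOver.relations ℝ ↔
      ∀ i, q i ∈ KZOver.relations ℚ := by
  refine ⟨soloInformed_realTensor_of_prep hprep
    (soloInformed_eq_zero_of_linearIndependent_algebraicClosure hc) q, fun hq => ?_⟩
  exact sum_mem fun i _ =>
    soloInformed_realScale_mem_relations (c i) (KZOver.baseChange_mem_relations ℝ (hq i))

/-- **THEOREM T⊗, inhomogeneous form**: for `(1, c₁, …, c_M)` linearly independent over the real
algebraic numbers, `(q₀ ⊗ ℝ) + ∑ᵢ cᵢ • (qᵢ ⊗ ℝ) ∈ relations ℝ ↔ q₀ ∈ relations ℚ ∧ ∀ i, qᵢ ∈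
relations ℚ`.  With `M = 1` this is THEOREM R (`c₁ ∉ k`); with `c` algebraically independent it
is the semi-generic theorem of file B2. [cite: KontsevichZagier2001, §1.2] -/
theorem soloInformed_realTensor_linIndep_cons_iff_prep (hprep : semialgebraicPreparation) {M : ℕ}
    {c : Fin M → ℝ}
    (hc : LinearIndependent (algebraicClosure ℚ ℝ) (Fin.cons 1 c : Fin (M + 1) → ℝ))
    (q₀ : KZOver.FormalRep ℚ) (q : Fin M → KZOver.FormalRep ℚ) :
    KZOver.baseChange ℚ ℝ q₀ + ∑ i, soloInformedRealScale (c i) (KZOver.baseChange ℚ ℝ (q i)) ∈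
        KZOver.relations ℝ ↔ q₀ ∈ KZOver.relations ℚ ∧ ∀ i, q i ∈ KZOver.relations ℚ := by
  have key := soloInformed_realTensor_linIndep_iff_prep hprep hc (Fin.cons q₀ q)
  rw [Fin.sum_univ_succ] at key
  simp only [Fin.cons_zero, Fin.cons_succ, soloInformed_realScale_one] at key
  rw [key, Fin.forall_fin_succ]
  simp only [Fin.cons_zero, Fin.cons_succ]

/-! ### Example: scalars `1, τ, τ², …` for `τ` transcendental -/

/-- Powers of a number transcendental over `ℚ` admit no nontrivial vanishing combination with
real-algebraic coefficients: `∑ⱼ gⱼ τʲ = 0`, all `gⱼ` algebraic over `ℚ` `⇒` all `gⱼ = 0`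
(`τ` is transcendental over the integral closure `ℝ ∩ ℚ̄` of `ℚ` in `ℝ`). [folklore] -/
theorem soloInformed_powers_eq_zero_of_transcendental {τ : ℝ} (hτ : Transcendental ℚ τ) {N : ℕ}
    (g : Fin N → ℝ) (hg : ∀ j, IsAlgebraic ℚ (g j)) (h : ∑ j : Fin N, g j * τ ^ (j : ℕ) = 0) :
    ∀ j, g j = 0 := by
  classical
  by_contra hne
  obtain ⟨j₀, hj₀⟩ := not_forall.1 hne
  have hK : Transcendental (integralClosure ℚ ℝ) τ := Transcendental.integralClosure (R := ℚ) hτ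
  let g' : Fin N → integralClosure ℚ ℝ := fun j =>
    ⟨g j, (mem_integralClosure_iff ℚ ℝ).2 (hg j).isIntegral⟩
  let p : Polynomial (integralClosure ℚ ℝ) := ∑ j : Fin N, Polynomial.monomial (j : ℕ) (g' j)
  have hcoeff : ∀ j : Fin N, p.coeff (j : ℕ) = g' j := fun j => by
    simp only [p, Polynomial.finsetSum_coeff, Polynomial.coeff_monomial]
    rw [Finset.sum_eq_single j]
    · rw [if_pos rfl]
    · intro j' _ hj'
      rw [if_neg]
      exact fun hjj => hj' (Fin.ext hjj)
    · intro hj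
      exact absurd (Finset.mem_univ j) hj
  have hp0 : p ≠ 0 := by
    intro hp
    apply hj₀
    have h₁ := hcoeff j₀
    rw [hp, Polynomial.coeff_zero] at h₁
    have h₂ : ((g' j₀ : integralClosure ℚ ℝ) : ℝ) = 0 := by
      rw [← h₁, ZeroMemClass.coe_zero]
    exact h₂
  have hpτ : Polynomial.aeval τ p = 0 := by
    simp only [p, map_sum, Polynomial.aeval_monomial, Subalgebra.algebraMap_apply]
    exact h
  exact hK ⟨p, hp0, hpτ⟩

/-- **THEOREM T⊗ for powers of a transcendental number** (conditional on the preparation fact):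
for `τ ∈ ℝ` transcendental over `ℚ` (e.g. `τ = π` or `τ = e`) and `ℚ`-data `r₀, …, r_{N-1}`,
`∑ⱼ τʲ • (rⱼ ⊗ ℝ) ∈ relations ℝ ↔ ∀ j, rⱼ ∈ relations ℚ`: a polynomial identity in `τ` between
classes of `ℚ`-defined integrals in `P_ℝ` holds only coefficientwise in `P_ℚ`.
[cite: KontsevichZagier2001, §1.2] -/
theorem soloInformed_realTensor_powers_iff_prep (hprep : semialgebraicPreparation) {τ : ℝ}
    (hτ : Transcendental ℚ τ) {N : ℕ} (r : Fin N → KZOver.FormalRep ℚ) :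
    ∑ j : Fin N, soloInformedRealScale (τ ^ (j : ℕ)) (KZOver.baseChange ℚ ℝ (r j)) ∈
        KZOver.relations ℝ ↔
      ∀ j, r j ∈ KZOver.relations ℚ := by
  refine ⟨soloInformed_realTensor_of_prep hprep
    (soloInformed_powers_eq_zero_of_transcendental hτ) r, fun hr => ?_⟩
  exact sum_mem fun j _ =>
    soloInformed_realScale_mem_relations _ (KZOver.baseChange_mem_relations ℝ (hr j))

end Summit.KontsevichZagierPeriods.KontsevichZagierPeriods.Theorems

end
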